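import Mathlib
import Summits.Ventures.PercRepro2.SortedPairs6Swap
import Summits.Ventures.PercRepro2.SortedPairs6Exch

/-!
# Sorted labellings of 6 pairs of points, III: the orbit minimum is sorted (blind cell PercRepro2, night-3, 2026-08-25)

Exchanging two misordered consecutive pairs lowers the code (`code12_exch6_lt_k`); with the swap
lemmas, the member of least code in the orbit of a list of 6 pairs under pair permutations and
end swaps (`act6`) is SORTED (`exists_sorted6`) — the coverage lemma of the fully
symmetry-reduced enumeration of the labellings of 6 typed edges.
-/

namespace Summit.Ventures.PercRepro2

open UnionCluster

namespace CovForm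

namespace TwoTyped

open OneTyped

section Sorted6

open Classical

variable {V : Type*} {E : Type*} (ends : E → Sym2 V) (o a₁ a₂ a₃ b : V) (ω : Config E)

/-- Toggling the swap flag of pair `k` swaps its ends in the acted list. -/
lemma act6_update (σ : Equiv.Perm (Fin 6)) (fl : Fin 6 → Bool) (ps : Fin 6 → V × V) (k : Fin 6) :
    act6 σ (Function.update fl k (!fl k)) ps = swapAt6 (act6 σ fl ps) k := by
  funext i
  by_cases hi : i = k
  · subst hi
    simp only [act6, swapAt6, Function.update_self]
    cases fl i <;> simp
  · simp only [act6, swapAt6, Function.update_of_ne hi]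

/-- Composing with the transposition of `k` and `k + 1` exchanges the two pairs in the acted list. -/
lemma act6_swap (σ : Equiv.Perm (Fin 6)) (fl : Fin 6 → Bool) (ps : Fin 6 → V × V) (k : Fin 6) :
    act6 ((Equiv.swap k (k + 1)).trans σ) (fl ∘ Equiv.swap k (k + 1)) ps = exch6 (act6 σ fl ps) k := by
  funext i
  simp only [act6, exch6, Equiv.trans_apply, Function.comp]

/-- **Every list of 6 pairs has a sorted member in its orbit**: the member of least code
under pair permutations and end swaps is sorted. -/
theorem exists_sorted6 (ps : Fin 6 → V × V) :
    ∃ (σ : Equiv.Perm (Fin 6)) (fl : Fin 6 → Bool), Sorted12 ends o a₁ a₂ a₃ b ω (act6 σ fl ps) := by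
  obtain ⟨g, hmin⟩ := Finite.exists_min
    (fun g : Equiv.Perm (Fin 6) × (Fin 6 → Bool) => code12 ends o a₁ a₂ a₃ b ω (xsOf6 (act6 g.1 g.2 ps)))
  refine ⟨g.1, g.2, ?_, ?_, ?_, ?_, ?_, ?_, ?_, ?_, ?_, ?_, ?_⟩
  · by_contra h
    simp only [not_le] at h
    have hm := hmin (g.1, Function.update g.2 0 (!g.2 0))
    simp only [act6_update] at hm
    exact absurd (code12_swapAt6_lt_0 ends o a₁ a₂ a₃ b ω _ h) (not_lt.mpr hm)
  · by_contra h
    simp only [not_le] at h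
    have hm := hmin (g.1, Function.update g.2 1 (!g.2 1))
    simp only [act6_update] at hm
    exact absurd (code12_swapAt6_lt_1 ends o a₁ a₂ a₃ b ω _ h) (not_lt.mpr hm)
  · by_contra h
    simp only [not_le] at h
    have hm := hmin (g.1, Function.update g.2 2 (!g.2 2))
    simp only [act6_update] at hm
    exact absurd (code12_swapAt6_lt_2 ends o a₁ a₂ a₃ b ω _ h) (not_lt.mpr hm)
  · by_contra h
    simp only [not_le] at h
    have hm := hmin (g.1, Function.update g.2 3 (!g.2 3))
    simp only [act6_update] at hm
    exact absurd (code12_swapAt6_lt_3 ends o a₁ a₂ a₃ b ω _ h) (not_lt.mpr hm)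
  · by_contra h
    simp only [not_le] at h
    have hm := hmin (g.1, Function.update g.2 4 (!g.2 4))
    simp only [act6_update] at hm
    exact absurd (code12_swapAt6_lt_4 ends o a₁ a₂ a₃ b ω _ h) (not_lt.mpr hm)
  · by_contra h
    simp only [not_le] at h
    have hm := hmin (g.1, Function.update g.2 5 (!g.2 5))
    simp only [act6_update] at hm
    exact absurd (code12_swapAt6_lt_5 ends o a₁ a₂ a₃ b ω _ h) (not_lt.mpr hm)
  · by_contra h
    have h' : lab ends o a₁ a₂ a₃ b (xsOf6 (act6 g.1 g.2 ps)) ω 7 < lab ends o a₁ a₂ a₃ b (xsOf6 (act6 g.1 g.2 ps)) ω 5 ∨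
        (lab ends o a₁ a₂ a₃ b (xsOf6 (act6 g.1 g.2 ps)) ω 7 = lab ends o a₁ a₂ a₃ b (xsOf6 (act6 g.1 g.2 ps)) ω 5 ∧
          lab ends o a₁ a₂ a₃ b (xsOf6 (act6 g.1 g.2 ps)) ω 8 < lab ends o a₁ a₂ a₃ b (xsOf6 (act6 g.1 g.2 ps)) ω 6) := by
      simp only [not_or, not_lt, not_and] at h
      omega
    have hm := hmin ((Equiv.swap (0 : Fin 6) (0 + 1)).trans g.1, g.2 ∘ Equiv.swap (0 : Fin 6) (0 + 1))
    simp only [act6_swap] at hm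
    exact absurd (code12_exch6_lt_0 ends o a₁ a₂ a₃ b ω _ h') (not_lt.mpr hm)
  · by_contra h
    have h' : lab ends o a₁ a₂ a₃ b (xsOf6 (act6 g.1 g.2 ps)) ω 9 < lab ends o a₁ a₂ a₃ b (xsOf6 (act6 g.1 g.2 ps)) ω 7 ∨
        (lab ends o a₁ a₂ a₃ b (xsOf6 (act6 g.1 g.2 ps)) ω 9 = lab ends o a₁ a₂ a₃ b (xsOf6 (act6 g.1 g.2 ps)) ω 7 ∧
          lab ends o a₁ a₂ a₃ b (xsOf6 (act6 g.1 g.2 ps)) ω 10 < lab ends o a₁ a₂ a₃ b (xsOf6 (act6 g.1 g.2 ps)) ω 8) := by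
      simp only [not_or, not_lt, not_and] at h
      omega
    have hm := hmin ((Equiv.swap (1 : Fin 6) (1 + 1)).trans g.1, g.2 ∘ Equiv.swap (1 : Fin 6) (1 + 1))
    simp only [act6_swap] at hm
    exact absurd (code12_exch6_lt_1 ends o a₁ a₂ a₃ b ω _ h') (not_lt.mpr hm)
  · by_contra h
    have h' : lab ends o a₁ a₂ a₃ b (xsOf6 (act6 g.1 g.2 ps)) ω 11 < lab ends o a₁ a₂ a₃ b (xsOf6 (act6 g.1 g.2 ps)) ω 9 ∨
        (lab ends o a₁ a₂ a₃ b (xsOf6 (act6 g.1 g.2 ps)) ω 11 = lab ends o a₁ a₂ a₃ b (xsOf6 (act6 g.1 g.2 ps)) ω 9 ∧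
          lab ends o a₁ a₂ a₃ b (xsOf6 (act6 g.1 g.2 ps)) ω 12 < lab ends o a₁ a₂ a₃ b (xsOf6 (act6 g.1 g.2 ps)) ω 10) := by
      simp only [not_or, not_lt, not_and] at h
      omega
    have hm := hmin ((Equiv.swap (2 : Fin 6) (2 + 1)).trans g.1, g.2 ∘ Equiv.swap (2 : Fin 6) (2 + 1))
    simp only [act6_swap] at hm
    exact absurd (code12_exch6_lt_2 ends o a₁ a₂ a₃ b ω _ h') (not_lt.mpr hm)
  · by_contra h
    have h' : lab ends o a₁ a₂ a₃ b (xsOf6 (act6 g.1 g.2 ps)) ω 13 < lab ends o a₁ a₂ a₃ b (xsOf6 (act6 g.1 g.2 ps)) ω 11 ∨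
        (lab ends o a₁ a₂ a₃ b (xsOf6 (act6 g.1 g.2 ps)) ω 13 = lab ends o a₁ a₂ a₃ b (xsOf6 (act6 g.1 g.2 ps)) ω 11 ∧
          lab ends o a₁ a₂ a₃ b (xsOf6 (act6 g.1 g.2 ps)) ω 14 < lab ends o a₁ a₂ a₃ b (xsOf6 (act6 g.1 g.2 ps)) ω 12) := by
      simp only [not_or, not_lt, not_and] at h
      omega
    have hm := hmin ((Equiv.swap (3 : Fin 6) (3 + 1)).trans g.1, g.2 ∘ Equiv.swap (3 : Fin 6) (3 + 1))
    simp only [act6_swap] at hm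
    exact absurd (code12_exch6_lt_3 ends o a₁ a₂ a₃ b ω _ h') (not_lt.mpr hm)
  · by_contra h
    have h' : lab ends o a₁ a₂ a₃ b (xsOf6 (act6 g.1 g.2 ps)) ω 15 < lab ends o a₁ a₂ a₃ b (xsOf6 (act6 g.1 g.2 ps)) ω 13 ∨
        (lab ends o a₁ a₂ a₃ b (xsOf6 (act6 g.1 g.2 ps)) ω 15 = lab ends o a₁ a₂ a₃ b (xsOf6 (act6 g.1 g.2 ps)) ω 13 ∧
          lab ends o a₁ a₂ a₃ b (xsOf6 (act6 g.1 g.2 ps)) ω 16 < lab ends o a₁ a₂ a₃ b (xsOf6 (act6 g.1 g.2 ps)) ω 14) := by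
      simp only [not_or, not_lt, not_and] at h
      omega
    have hm := hmin ((Equiv.swap (4 : Fin 6) (4 + 1)).trans g.1, g.2 ∘ Equiv.swap (4 : Fin 6) (4 + 1))
    simp only [act6_swap] at hm
    exact absurd (code12_exch6_lt_4 ends o a₁ a₂ a₃ b ω _ h') (not_lt.mpr hm)

end Sorted6

end TwoTyped

end CovForm

end Summit.Ventures.PercRepro2
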